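import Summits.QuantumFields.YangMills.Theorems.LuscherReductionDressedRitzPolyakovLiftCorrLogConvex
import Summits.QuantumFields.YangMills.Theorems.LuscherReductionDressedRitzVacuumDictionary
import HarnessLib

/-!
# Route `LuscherReduction`, item `DressedRitz` (stmt-QuantumFields-20205), line «polyakovlift» r5 — the normalised connected correlator is NON-INCREASING in
# the separation (`corr_{t+1,ii} ≤ corr_{t,ii}`: the effective mass is ≥ 0), and the per-step ratio lies in `[corr_1/corr_0, 1]`

Support module (LEAD prover ym-lead-20205-polyakovlift g0; `--supports stmt-QuantumFields-20205`, helper).  Companion of `…CorrLogConvex` (log-convexity,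
`corr_ratio_mono`): the top bound of the form (`⟨w,K_βw⟩ ≤ λ₀‖w‖²`, tree `VacDict.qform_self_le_levelValue_zero_mul`) gives the EVEN steps
`corr_{2s+1} ≤ corr_{2s}`, and log-convexity transports it to the ODD steps (`corr_{2s+2}² ≤ corr_{2s+1}corr_{2s+3} ≤ corr_{2s+1}corr_{2s+2}`):

* `corr_even_succ_le` — `corr β φ G (2s+1) i i ≤ corr β φ G (2s) i i`;
* ★ `corr_succ_le` — `corr β φ G (t+1) i i ≤ corr β φ G t i i` for every `t` (effective mass `≥ 0`);
* `corr_le_corr_zero` — `corr_{t,ii} ≤ corr_{0,ii} = ‖ins φ G_i‖²` (a-priori size bound for every slab-limit number in the S-UNIV′/S-LEAK clauses).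

HONEST FRAMING: fixed-lattice functional analysis on the conditional femto rung R2b1; no estimate toward any stub; nothing here bears on infinite volume, the
continuum limit or the Clay gap.  References: M. Lüscher, U. Wolff, NPB 339 (1990) 222 [cite: LuscherWolff1990]; E. Seiler, LNP 159 [cite: SeilerLNP1982, §3].
-/

set_option autoImplicit false

noncomputable section

open MeasureTheory Filter Topology Real
open Literature.MathematicalPhysics.QuantumFieldTheory (GaugeConfig Site gaugeTransform)
open scoped BigOperators

namespace Summit.QuantumFields.YangMills.Theorems.FemtoTransferGap.PolyakovLift

open Summit.QuantumFields.YangMills.Theorems.FemtoTransferGap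

/-- Even steps: `corr_{2s+1,ii} ≤ corr_{2s,ii}` (the form is bounded by the top value on `K^[s] ins φ G_i`). [cite: LuscherWolff1990] -/
theorem corr_even_succ_le {M : ℕ} [NeZero M] {k : ℕ} {β : ℝ} (hβ : 0 < β) {φ : GaugeConfig 3 M SU2 → ℝ} (hφ : IsPhys φ)
    {G : Fin k → (GaugeConfig 3 M SU2 → ℝ)} (hG : ∀ i, IsPhys (G i)) (s : ℕ) (i : Fin k) :
    corr β φ G (2 * s + 1) i i ≤ corr β φ G (2 * s) i i := by
  have hl0 : 0 < levelValue su2Rep M β 0 := levelValue_su2Rep_pos hβ 0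
  set v := (transferApply (L := M) β)^[s] (OpPlat.ins φ (G i)) with hv
  have hvP : IsPhys v := isPhys_iterate_transferApply β (OpPlat.isPhys_ins hφ (hG i)) s
  have htop : l2 v (transferApply β v) ≤ levelValue su2Rep M β 0 * l2 v v := by
    rw [← qform_eq_l2_transferApply]; exact VacDict.qform_self_le_levelValue_zero_mul β hvP
  rw [hv, corr_dressed_form hβ hφ hG s i i, corr_dressed_norm hβ hφ hG s i i, pow_succ] at htop
  -- cancel `λ₀^{2s} · λ₀ > 0`
  have hP : 0 < levelValue su2Rep M β 0 ^ (2 * s) * levelValue su2Rep M β 0 := mul_pos (pow_pos hl0 _) hl0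
  have h' : levelValue su2Rep M β 0 ^ (2 * s) * levelValue su2Rep M β 0 * corr β φ G (2 * s + 1) i i ≤
      levelValue su2Rep M β 0 ^ (2 * s) * levelValue su2Rep M β 0 * corr β φ G (2 * s) i i := by
    calc levelValue su2Rep M β 0 ^ (2 * s) * levelValue su2Rep M β 0 * corr β φ G (2 * s + 1) i i
        ≤ levelValue su2Rep M β 0 * (levelValue su2Rep M β 0 ^ (2 * s) * corr β φ G (2 * s) i i) := htop
      _ = levelValue su2Rep M β 0 ^ (2 * s) * levelValue su2Rep M β 0 * corr β φ G (2 * s) i i := by ring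
  exact le_of_mul_le_mul_left h' hP

/-- ★ **The connected correlator is non-increasing in the separation**: `corr_{t+1,ii} ≤ corr_{t,ii}` for every `t` (effective mass `≥ 0`); odd steps by
log-convexity. [cite: LuscherWolff1990] -/
theorem corr_succ_le {M : ℕ} [NeZero M] {k : ℕ} {β : ℝ} (hβ : 0 < β) {φ : GaugeConfig 3 M SU2 → ℝ} (hφ : IsPhys φ)
    {G : Fin k → (GaugeConfig 3 M SU2 → ℝ)} (hG : ∀ i, IsPhys (G i)) (t : ℕ) (i : Fin k) :
    corr β φ G (t + 1) i i ≤ corr β φ G t i i := by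
  obtain ⟨s, rfl | rfl⟩ := Nat.even_or_odd' t
  · exact corr_even_succ_le hβ hφ hG s i
  · -- odd: `c_{2s+2}² ≤ c_{2s+1} c_{2s+3} ≤ c_{2s+1} c_{2s+2}` and `c_{2s+2} ≥ 0`
    have hc := corr_logConvex hβ hφ hG (2 * s + 1) i
    have hnext : corr β φ G (2 * s + 1 + 2) i i ≤ corr β φ G (2 * s + 1 + 1) i i := by
      have := corr_even_succ_le hβ hφ hG (s + 1) i
      rw [show 2 * (s + 1) + 1 = 2 * s + 1 + 2 by ring, show 2 * (s + 1) = 2 * s + 1 + 1 by ring] at this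
      exact this
    have h1 : 0 ≤ corr β φ G (2 * s + 1) i i := corr_diag_nonneg hβ hφ hG _ i
    have h2 : 0 ≤ corr β φ G (2 * s + 1 + 1) i i := corr_diag_nonneg hβ hφ hG _ i
    -- `c2² ≤ c1 * c3 ≤ c1 * c2` ⇒ `c2 (c2 − c1) ≤ 0` ⇒ `c2 ≤ c1` when `c2 > 0`; trivial when `c2 = 0`
    rcases h2.eq_or_lt with h0 | hpos
    · rw [← h0]; exact h1
    · have h3 : corr β φ G (2 * s + 1 + 1) i i ^ 2 ≤ corr β φ G (2 * s + 1) i i * corr β φ G (2 * s + 1 + 1) i i :=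
        hc.trans (mul_le_mul_of_nonneg_left hnext h1)
      rw [sq] at h3
      exact le_of_mul_le_mul_right h3 hpos

/-- `corr_{t,ii} ≤ corr_{0,ii}` for every `t`. [cite: LuscherWolff1990] -/
theorem corr_le_corr_zero {M : ℕ} [NeZero M] {k : ℕ} {β : ℝ} (hβ : 0 < β) {φ : GaugeConfig 3 M SU2 → ℝ} (hφ : IsPhys φ)
    {G : Fin k → (GaugeConfig 3 M SU2 → ℝ)} (hG : ∀ i, IsPhys (G i)) (t : ℕ) (i : Fin k) :
    corr β φ G t i i ≤ corr β φ G 0 i i := by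
  induction t with
  | zero => exact le_rfl
  | succ t ih => exact (corr_succ_le hβ hφ hG t i).trans ih

/-- `corr_{0,ii} = ‖ins φ G_i‖²`. [folklore] -/
theorem corr_zero_eq {M : ℕ} [NeZero M] {k : ℕ} (β : ℝ) (φ : GaugeConfig 3 M SU2 → ℝ) (G : Fin k → (GaugeConfig 3 M SU2 → ℝ)) (i l : Fin k) :
    corr β φ G 0 i l = l2 (OpPlat.ins φ (G i)) (OpPlat.ins φ (G l)) := by
  simp [corr]

end Summit.QuantumFields.YangMills.Theorems.FemtoTransferGap.PolyakovLift

end
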